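import Summits.Schanuel.Schanuel.Theorems.RootDecomp1BAlgFrame01

/-!
# RootDecomp1BAlgFrame — lens 4, generation 40 «UNBOUNDED-DEGREE FRAMES» (lane B-R24 (b′), PRICE B-β, RULE B-R26): X(2) and the three At-cells at (1 | ρ) for every ρ in the class `AlgUltraLiouville` (doubly-exponential hyper-approximation by real algebraic irrationals of UNBOUNDED degree) modulo `Roy2014_thm_1_1` ONLY — the degree a running parameter of Roy's point-explicit L–W measure (budget lemma `algFrameMeasure_explicit_of_roy` with the floor exp(−royC D·exp(A^8)·(1+log H)) in its TYPE); the NAMED MEMBER ρ_A (a tower over 2^{1/p}, prime degrees p → ∞) with HYPOTHESIS-FREE membership, degree certificate [ℚ(β_K):ℚ] = g_K, position certificate |ρ_A − γ| ≥ exp(−A⁴) and the exclusions BY TREE NAMES (¬Hyper, ¬QuadHyper, ¬Ultra ×2, ¬LiouvilleOrder 8, transcendental) — continuation (RootDecomp1BAlgFrame02): §R the budget lemma (Roy ⟹ algebraic frame measure)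

(lens-4 g40 HOME kernel AlgFrame.lean fe3f4606…, 1974 l, imports tree RootDecomp1BQuadFrame05 + RootDecomp1EPointTransfer04 only; CLAIM L2078, RULING + CHECKLIST B-g40 L2080, NODE L2101 / REQUEST L2102 / RESULT L2103, critic VERDICT L2111 (crit g9: (A) CLEARED — ONE CELL (B-β); lens-4 tally THEOREM ×6 + CELL ×3; RULE B-R26 in force (the Roy-transfer line on 1B CLOSED); PORT GO 01–09 `--supports stmt-Schanuel-24622`); port by census-1 gen 18 as `RootDecomp1BAlgFrame01`–`09` along K's sections: 01 = §D the class `AlgUltraLiouville` + the measure shape `AlgFrameMeasure` + §R helpers (`royC`); 02 = §R the budget lemma `algFrameMeasure_explicit_of_roy` (Roy ⟹ the algebraic frame measure in EVERY degree; scoped `maxHeartbeats 1600000` carried as in K); 03 = §E the engine `algebraicIndependent_exp_frame_of_algUltraLiouville (hRoy)` + the `![…]` forms; 04 = §M.1–§M.3 prime degrees `gdeg`, radicals `theta`, frame data `Nseq`/`Pseq`/`fd` (with `attribute [irreducible] fd`), `betaSeq`, `fSeq`, `ASeq`, growth; 05 = §M.4–§M.5 increments, the limit `rhoA`, MEMBERSHIP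 `algUltraLiouville_rhoA`; 06 = §M.6–§M.7 degree certificate `finrank_adjoin_theta` / `adjoin_betaSeq_eq` + the number-field Liouville inequality (`FK`, `thetaF`, `sigma0`, norm to ℚ); 07 = §M.8–§M.9 the frame bound, the tower inequality, scale selection, `cert_arith`; 08 = §M.10–§M.11 THE POSITION CERTIFICATE `rhoA_far_from_degree_le` + EXCLUSIONS by tree names (`not_hyperLiouville_rhoA`, `not_quadHyperLiouville_rhoA`, `not_ultraLiouville_rhoA` / `'`, `not_liouvilleOrder_rhoA`, `transcendental_rhoA`); 09 = §C the cells `four_le_polarDeg_one_of_algUltra (hRoy)` (+ swap), the At-cells, the member cells at ρ_A, `rhoA_position`.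
PORT EDITS: the three `set_option linter.*` lines dropped and the one surfaced `unnecessarySimpa` fixed (`simpa using h12` ↦ `simp`, §R); 74 one-line docstrings added; two generic helpers made `private` (`three_mul_le_two_pow`, `half_identity`) with per-part private copies of those and of K's own private helpers; statements and proofs verbatim. `--supports stmt-Schanuel-24622`; no census credit carried; rung 0 — nothing here proves Schanuel.)
-/

noncomputable section

open Complex IntermediateField MvPolynomial

namespace Summit.Schanuel.Schanuel.Theorems.RootDecomp1BAlgFrame

open Summit.Schanuel.Schanuel.Theorems.RootDecomp1EPointTransfer (Roy2014_thm_1_1)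
open Summit.Schanuel.Schanuel.Theorems.RootDecomp1KHyper (mvlen mvlen_nonneg abs_coeff_le_mvlen one_le_mvlen)
open Summit.Schanuel.Schanuel.Theorems.RootDecomp1BHyperFrame (royDeg royS RoyNF roy_tree_iff framePt Ff
  Ff_eq_aeval exists_lipschitz_Ff linearIndependent_one_irrational)
open Summit.Schanuel.Schanuel.Theorems.RootDecomp1BQuadFrame (qy qe qpt qpt_apply framePt_qy_qe linearIndependent_qpt
  QuadHyperLiouville)
open Summit.Schanuel.Schanuel.Theorems.RootDecomp1BFedFlagCore (KleinIH polarDeg polarField)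
open Summit.Schanuel.Schanuel.Theorems.RootDecomp1BDefectFloorDefs (SharpRelativeLindemannAt TameDefectZeroAt
  WildSharpDefectZeroAt WildSharpDefectZeroInitAt WildSharpInitAt)
open Summit.Schanuel.Schanuel.Theorems.RootDecomp1BDefectFloorCells (natCast_le_trdeg_of_algebraicIndependent)
open Summit.Schanuel.Schanuel.Theorems.RootDecomp1BRadicalDescent (exists_int_relation)
open Summit.Schanuel.Schanuel.Theorems.RootDecomp1BMovingZero (mem_polarField_one mem_polarField_swap)

section RoyAdapter

/-- An integer is an algebraic integer in `ℂ`. -/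
private theorem isIntegral_intCast_AF (z : ℤ) : IsIntegral ℤ (z : ℂ) := by
  simpa using (isIntegral_algebraMap (R := ℤ) (A := ℂ) (x := z))

/-- `i` is an algebraic integer. -/
private theorem isIntegral_I_AF : IsIntegral ℤ I := by
  refine ⟨Polynomial.X ^ 2 + Polynomial.C 1, Polynomial.monic_X_pow_add_C 1 two_ne_zero, ?_⟩
  simp [Polynomial.eval₂_add, Polynomial.eval₂_X_pow, Complex.I_sq]

open Polynomial in

/-- `x ≤ exp x`. -/
private theorem le_exp_self (x : ℝ) : x ≤ Real.exp x := by linarith [Real.add_one_le_exp x]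

set_option maxHeartbeats 1600000 in
/-- **ROY ⟹ ALGEBRAIC FRAME MEASURE, EXPLICIT FLOOR** (the budget lemma; the constants `C_D = royC D`, `N = 8` are in
the TYPE).  Roy's bound depends on the point `α_β = (1, β, i, iβ)` only through `d = [ℚ(α_β):ℚ] ≤ 2·deg f ≤ 2A`, the
house `≤ A + 1` and the denominator `|lead f| ≤ A`; the degree enters through `S = 576·d·(D+1)` inside ONE exponential
`exp(−(cqS)^{18 S⁴}) = exp(−exp(18 S⁴ log(cqS)))`, whence the doubly-exponential but degree-free shape
`exp(−C_D·exp(A^8)·(1 + log H))`. -/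
theorem algFrameMeasure_explicit_of_roy (hRoy : Roy2014_thm_1_1) (D : ℕ) :
    ∀ (β : ℝ) (f : Polynomial ℤ) (A : ℕ), Irrational β → f ≠ 0 → f.natDegree ≤ A →
      (∀ i, |f.coeff i| ≤ (A : ℤ)) → Polynomial.aeval β f = 0 →
    ∀ P : MvPolynomial (Fin 4) ℤ, P ≠ 0 → P.totalDegree ≤ D →
    ∀ H : ℕ, 1 ≤ H → (∀ s, |P.coeff s| ≤ (H : ℤ)) →
      Real.exp (-(royC D * Real.exp ((A : ℝ) ^ 8) * (1 + Real.log H))) ≤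
        ‖MvPolynomial.aeval (fun j => cexp (qpt β j)) P‖ := by
  have hRoy : RoyNF := roy_tree_iff.mp hRoy
  classical
  -- constants depending on `D` only
  obtain ⟨D', hD'⟩ : ∃ D' : ℕ, D' = D + 1 := ⟨_, rfl⟩
  obtain ⟨s₁, hs₁⟩ : ∃ s₁ : ℕ, s₁ = royS 4 2 D' := ⟨_, rfl⟩
  have hs₁pos : 0 < s₁ := by rw [hs₁]; unfold royS; rw [hD']; positivity
  obtain ⟨L₀, hL₀⟩ : ∃ L₀ : ℝ, L₀ = (36 * (s₁ : ℝ) ^ 5) ^ 8 := ⟨_, rfl⟩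
  obtain ⟨C, hC⟩ : ∃ C : ℝ, C = 6 * (s₁ : ℝ) ^ 4 + Real.exp L₀ := ⟨_, rfl⟩
  have hC6 : 6 * (s₁ : ℝ) ^ 4 ≤ C := by rw [hC]; linarith [Real.exp_pos L₀]
  have hCexp : Real.exp L₀ ≤ C := by rw [hC]; linarith [pow_nonneg (Nat.cast_nonneg s₁ : (0:ℝ) ≤ s₁) 4]
  have hC1 : 1 ≤ C := le_trans (Real.one_le_exp (by rw [hL₀]; positivity)) hCexp
  have hC0 : 0 ≤ C := le_trans zero_le_one hC1
  have hroyC : royC D = C := by rw [hC, hL₀, hs₁, hD']; rfl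
  intro β f A hirr hf0 hfdeg hfA hfβ P hP hPD H hH hPH
  rw [hroyC]
  have hβC : Polynomial.aeval ((β : ℝ) : ℂ) f = 0 := by
    rw [aeval_ofReal_int, hfβ, Complex.ofReal_zero]
  -- the same polynomial over `ℚ`
  set p : Polynomial ℚ := f.map (Int.castRingHom ℚ) with hpdef
  -- `A ≥ 1` (a non-zero coefficient of `f` is bounded by `A`)
  have hA1Z : (1 : ℤ) ≤ A := by
    have hne : f.leadingCoeff ≠ 0 := Polynomial.leadingCoeff_ne_zero.mpr hf0
    exact le_trans (Int.one_le_abs hne) (hfA f.natDegree)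
  have hA1N : 1 ≤ A := by exact_mod_cast hA1Z
  have hA1 : (1 : ℝ) ≤ A := by exact_mod_cast hA1N
  have hA0 : (0 : ℝ) ≤ A := le_trans zero_le_one hA1
  -- the number field `K = ℚ(β) ⊔ ℚ(i)` and its degree `≤ 2 deg f ≤ 2A`
  obtain ⟨hβint, hβdeg⟩ := finrank_adjoin_root_le hf0 hβC
  have hIf : Polynomial.aeval I (Polynomial.X ^ 2 + Polynomial.C (1 : ℤ)) = 0 := by simp
  have hIf0 : (Polynomial.X ^ 2 + Polynomial.C (1 : ℤ) : Polynomial ℤ) ≠ 0 :=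
    (Polynomial.monic_X_pow_add_C (1 : ℤ) two_ne_zero).ne_zero
  obtain ⟨hIint, hIdeg⟩ := finrank_adjoin_root_le hIf0 hIf
  have hIdeg2 : Module.finrank ℚ ℚ⟮I⟯ ≤ 2 := hIdeg.trans (by
    rw [Polynomial.natDegree_X_pow_add_C])
  haveI : FiniteDimensional ℚ ℚ⟮((β : ℝ) : ℂ)⟯ := IntermediateField.adjoin.finiteDimensional hβint
  haveI : FiniteDimensional ℚ ℚ⟮I⟯ := IntermediateField.adjoin.finiteDimensional hIint
  set K : IntermediateField ℚ ℂ := ℚ⟮((β : ℝ) : ℂ)⟯ ⊔ ℚ⟮I⟯ with hKdef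
  haveI hKfd : FiniteDimensional ℚ ↥K := IntermediateField.finiteDimensional_sup _ _
  have hKdeg : Module.finrank ℚ ↥K ≤ 2 * A := by
    refine (IntermediateField.finrank_sup_le _ _).trans ?_
    calc Module.finrank ℚ ℚ⟮((β : ℝ) : ℂ)⟯ * Module.finrank ℚ ℚ⟮I⟯ ≤ A * 2 :=
        Nat.mul_le_mul (hβdeg.trans hfdeg) hIdeg2
      _ = 2 * A := by ring
  have hβK : ((β : ℝ) : ℂ) ∈ K := (le_sup_left : ℚ⟮((β : ℝ) : ℂ)⟯ ≤ K) (mem_adjoin_simple_self ℚ _)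
  have hIK : I ∈ K := (le_sup_right : ℚ⟮I⟯ ≤ K) (mem_adjoin_simple_self ℚ _)
  have hmem : ∀ j, qpt β j ∈ K := by
    intro j
    rw [qpt_apply]
    fin_cases j
    · simp
    · simpa using hβK
    · simpa using hIK
    · simpa using mul_mem hβK hIK
  let α : Fin 4 → ↥K := fun j => ⟨qpt β j, hmem j⟩
  have hαcoe : ∀ j, (α j : ℂ) = qpt β j := fun j => rfl
  let βK : ↥K := ⟨((β : ℝ) : ℂ), hβK⟩
  let IK : ↥K := ⟨I, hIK⟩
  have hinj : Function.Injective (algebraMap ↥K ℂ) := (algebraMap ↥K ℂ).injective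
  -- `f(βK) = 0` in `K` (stated for `p = f` over `ℚ`)
  have hβKeq : Polynomial.aeval βK p = 0 := by
    apply hinj
    rw [← Polynomial.aeval_algebraMap_apply, map_zero]
    show Polynomial.aeval ((β : ℝ) : ℂ) p = 0
    rw [hpdef, aeval_map_int, hβC]
  have hIKeq : IK ^ 2 = -1 := by
    apply hinj
    rw [map_pow, map_neg, map_one]
    exact Complex.I_sq
  have hαK : ∀ j, α j = ![(1 : ↥K), βK, IK, βK * IK] j := by
    intro j
    apply Subtype.ext
    rw [hαcoe, qpt_apply]
    fin_cases j <;> simp [βK, IK]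
  -- ℚ-linear independence
  have hαli : LinearIndependent ℚ (fun j => (α j : ℂ)) := linearIndependent_qpt hirr
  -- the house `≤ A + 1`
  have hconj : ∀ (j : Fin 4) (σ : ↥K →ₐ[ℚ] ℂ), ‖σ (α j)‖ ≤ (A : ℝ) + 1 := by
    intro j σ
    have hσβ : ‖σ βK‖ ≤ (A : ℝ) + 1 := by
      refine norm_root_le hf0 hfA (z := σ βK) ?_
      have h := congrArg σ hβKeq
      rw [← Polynomial.aeval_algHom_apply, map_zero, hpdef, aeval_map_int] at h
      exact h
    have hσI : ‖σ IK‖ = 1 := by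
      have h := congrArg σ hIKeq
      rw [map_pow, map_neg, map_one] at h
      have h2 : ‖σ IK‖ ^ 2 = 1 := by
        have := congrArg (fun w : ℂ => ‖w‖) h
        simpa [norm_pow] using this
      exact (pow_eq_one_iff_of_nonneg (norm_nonneg _) two_ne_zero).mp h2
    have h12 : (1 : ℝ) ≤ (A : ℝ) + 1 := by linarith
    rw [hαK j]
    fin_cases j
    · simp
    · simpa using hσβ
    · simp [hσI]
    · simpa [hσI] using hσβ
  -- the denominator `q = |lead f| ≤ A`
  obtain ⟨q, hq⟩ : ∃ q : ℕ, q = f.leadingCoeff.natAbs := ⟨_, rfl⟩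
  have hqpos : 0 < q := by
    rw [hq]; exact Int.natAbs_pos.mpr (Polynomial.leadingCoeff_ne_zero.mpr hf0)
  have hqA : (q : ℝ) ≤ A := by
    have h1 : (q : ℤ) ≤ A := by
      rw [hq, Int.natCast_natAbs]; exact hfA f.natDegree
    exact_mod_cast h1
  have hγint : IsIntegral ℤ ((q : ℂ) * ((β : ℝ) : ℂ)) := by rw [hq]; exact isIntegral_natAbs_lead_mul hβC
  have hqint : ∀ j, IsIntegral ℤ ((q : ℂ) * (α j : ℂ)) := by
    have h0 : IsIntegral ℤ (q : ℂ) := by simpa using isIntegral_intCast_AF q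
    have h2 : IsIntegral ℤ ((q : ℂ) * I) := h0.mul isIntegral_I_AF
    have h3 : IsIntegral ℤ ((q : ℂ) * (((β : ℝ) : ℂ) * I)) := by
      rw [← mul_assoc]; exact hγint.mul isIntegral_I_AF
    intro j
    rw [hαcoe, qpt_apply]
    fin_cases j
    exacts [by simpa using h0, by simpa using hγint, by simpa using h2, by simpa using h3]
  -- Roy's theorem at `α_β`
  have hD'pos : 0 < D' := by rw [hD']; exact Nat.succ_pos D
  have hPD' : P.totalDegree ≤ D' := hPD.trans (by rw [hD']; exact Nat.le_succ D)
  have hHpos : 0 < H := hH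
  have hroy := hRoy 4 K hKfd α hαli ((A : ℝ) + 1) hconj q hqpos hqint D' H hD'pos hHpos P hP hPD' hPH
  -- the degree `d ≤ 2A`
  obtain ⟨dα, hdα⟩ : ∃ dα : ℕ, royDeg (fun i => (α i : ℂ)) = dα := ⟨_, rfl⟩
  have hd2A : dα ≤ 2 * A := by
    rw [← hdα]
    unfold royDeg
    have hle : IntermediateField.adjoin ℚ (Set.range fun i => (α i : ℂ)) ≤ K := by
      rw [IntermediateField.adjoin_le_iff]
      rintro _ ⟨j, rfl⟩
      exact (α j).2
    exact (IntermediateField.finrank_le_of_le_right hle).trans hKdeg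
  rw [hdα] at hroy
  obtain ⟨S, hS⟩ : ∃ S : ℕ, royS 4 dα D' = S := ⟨_, rfl⟩
  rw [hS] at hroy
  have hSle : S ≤ s₁ * A := by
    rw [← hS, hs₁]
    unfold royS
    calc 6 * dα * 4 * Nat.factorial 4 * D' ≤ 6 * (2 * A) * 4 * Nat.factorial 4 * D' := by gcongr
      _ = 6 * 2 * 4 * Nat.factorial 4 * D' * A := by ring
  have hpt : (fun i => cexp (α i : ℂ)) = fun j => cexp (qpt β j) := rfl
  rw [hpt] at hroy
  refine le_trans ?_ hroy
  -- compare the two shapes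
  have hH1 : (1 : ℝ) ≤ H := by exact_mod_cast hH
  have hHposR : (0 : ℝ) < H := by positivity
  have hlogH : 0 ≤ Real.log H := Real.log_nonneg hH1
  have hs₁R : (1 : ℝ) ≤ s₁ := by exact_mod_cast hs₁pos
  have hSR : (S : ℝ) ≤ s₁ * A := by exact_mod_cast hSle
  have hS0 : (0 : ℝ) ≤ S := Nat.cast_nonneg _
  have hdR : (dα : ℝ) ≤ 2 * A := by exact_mod_cast hd2A
  -- exponent 1: `3 d S⁴ ≤ 6 s₁⁴ A⁵ ≤ C exp(A⁸)`
  have hE1 : (3 * dα * S ^ 4 : ℕ) * Real.log H ≤ C * Real.exp ((A : ℝ) ^ 8) * Real.log H := by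
    refine mul_le_mul_of_nonneg_right ?_ hlogH
    have h1 : ((3 * dα * S ^ 4 : ℕ) : ℝ) ≤ 6 * (s₁ : ℝ) ^ 4 * (A : ℝ) ^ 5 := by
      push_cast
      calc (3 : ℝ) * dα * (S : ℝ) ^ 4 ≤ 3 * (2 * A) * ((s₁ : ℝ) * A) ^ 4 := by gcongr
        _ = 6 * (s₁ : ℝ) ^ 4 * (A : ℝ) ^ 5 := by ring
    have h2 : (A : ℝ) ^ 5 ≤ Real.exp ((A : ℝ) ^ 8) :=
      (pow_le_pow_right₀ hA1 (by norm_num : 5 ≤ 8)).trans (le_exp_self _)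
    calc ((3 * dα * S ^ 4 : ℕ) : ℝ) ≤ 6 * (s₁ : ℝ) ^ 4 * (A : ℝ) ^ 5 := h1
      _ ≤ C * Real.exp ((A : ℝ) ^ 8) := mul_le_mul hC6 h2 (by positivity) hC0
  -- exponent 2: `((A+1) q S)^{18 S⁴} ≤ exp(36 s₁⁵ A⁷) ≤ C exp(A⁸)`
  have hbase : ((A : ℝ) + 1) * (q : ℝ) * (S : ℝ) ≤ 2 * (s₁ : ℝ) * (A : ℝ) ^ 3 := by
    calc ((A : ℝ) + 1) * (q : ℝ) * (S : ℝ) ≤ (2 * A) * A * ((s₁ : ℝ) * A) := by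
          gcongr
          linarith
      _ = 2 * (s₁ : ℝ) * (A : ℝ) ^ 3 := by ring
  have hbase0 : (0 : ℝ) ≤ ((A : ℝ) + 1) * (q : ℝ) * (S : ℝ) := by positivity
  have hexp18 : 18 * S ^ 4 ≤ 18 * (s₁ * A) ^ 4 := by gcongr
  have hb1 : (1 : ℝ) ≤ 2 * (s₁ : ℝ) * (A : ℝ) ^ 3 := by
    have : (1 : ℝ) ≤ (A : ℝ) ^ 3 := one_le_pow₀ hA1
    nlinarith
  have hE2a : (((A : ℝ) + 1) * (q : ℝ) * (S : ℝ)) ^ (18 * S ^ 4) ≤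
      Real.exp (36 * (s₁ : ℝ) ^ 5 * (A : ℝ) ^ 7) := by
    calc (((A : ℝ) + 1) * (q : ℝ) * (S : ℝ)) ^ (18 * S ^ 4)
        ≤ (2 * (s₁ : ℝ) * (A : ℝ) ^ 3) ^ (18 * S ^ 4) := pow_le_pow_left₀ hbase0 hbase _
      _ ≤ (2 * (s₁ : ℝ) * (A : ℝ) ^ 3) ^ (18 * (s₁ * A) ^ 4) := pow_le_pow_right₀ hb1 hexp18
      _ ≤ (Real.exp (2 * (s₁ : ℝ) * (A : ℝ) ^ 3)) ^ (18 * (s₁ * A) ^ 4) :=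
          pow_le_pow_left₀ (by positivity) (le_exp_self _) _
      _ = Real.exp (36 * (s₁ : ℝ) ^ 5 * (A : ℝ) ^ 7) := by
          rw [← Real.exp_nat_mul]; congr 1; push_cast; ring
  have hE2 : (((A : ℝ) + 1) * (q : ℝ) * (S : ℝ)) ^ (18 * S ^ 4) ≤ C * Real.exp ((A : ℝ) ^ 8) := by
    refine hE2a.trans ?_
    by_cases hcase : 36 * (s₁ : ℝ) ^ 5 ≤ A
    · -- large `A`: `36 s₁⁵ A⁷ ≤ A⁸`
      have h1 : 36 * (s₁ : ℝ) ^ 5 * (A : ℝ) ^ 7 ≤ (A : ℝ) ^ 8 := by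
        calc 36 * (s₁ : ℝ) ^ 5 * (A : ℝ) ^ 7 ≤ (A : ℝ) * (A : ℝ) ^ 7 :=
            mul_le_mul_of_nonneg_right hcase (by positivity)
          _ = (A : ℝ) ^ 8 := by ring
      calc Real.exp (36 * (s₁ : ℝ) ^ 5 * (A : ℝ) ^ 7) ≤ Real.exp ((A : ℝ) ^ 8) := Real.exp_le_exp.mpr h1
        _ = 1 * Real.exp ((A : ℝ) ^ 8) := (one_mul _).symm
        _ ≤ C * Real.exp ((A : ℝ) ^ 8) := mul_le_mul_of_nonneg_right hC1 (Real.exp_pos _).le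
    · -- small `A`: `36 s₁⁵ A⁷ ≤ (36 s₁⁵)⁸ = L₀`
      push Not at hcase
      have h1 : 36 * (s₁ : ℝ) ^ 5 * (A : ℝ) ^ 7 ≤ L₀ := by
        rw [hL₀]
        calc 36 * (s₁ : ℝ) ^ 5 * (A : ℝ) ^ 7 ≤ 36 * (s₁ : ℝ) ^ 5 * (36 * (s₁ : ℝ) ^ 5) ^ 7 := by
              gcongr
          _ = (36 * (s₁ : ℝ) ^ 5) ^ 8 := by ring
      calc Real.exp (36 * (s₁ : ℝ) ^ 5 * (A : ℝ) ^ 7) ≤ Real.exp L₀ := Real.exp_le_exp.mpr h1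
        _ ≤ C := hCexp
        _ = C * 1 := (mul_one C).symm
        _ ≤ C * Real.exp ((A : ℝ) ^ 8) :=
            mul_le_mul_of_nonneg_left (Real.one_le_exp (by positivity)) hC0
  -- assemble
  have hHA : ((H : ℝ) ^ (3 * dα * S ^ 4))⁻¹ = Real.exp (-((3 * dα * S ^ 4 : ℕ) * Real.log H)) := by
    rw [← Real.log_pow, Real.exp_neg, Real.exp_log (pow_pos hHposR _)]
  have hsum : (3 * dα * S ^ 4 : ℕ) * Real.log H + (((A : ℝ) + 1) * (q : ℝ) * (S : ℝ)) ^ (18 * S ^ 4) ≤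
      C * Real.exp ((A : ℝ) ^ 8) * (1 + Real.log H) := by
    have h := add_le_add hE1 hE2
    linarith
  calc Real.exp (-(C * Real.exp ((A : ℝ) ^ 8) * (1 + Real.log H)))
      ≤ Real.exp (-((3 * dα * S ^ 4 : ℕ) * Real.log H + (((A : ℝ) + 1) * (q : ℝ) * (S : ℝ)) ^ (18 * S ^ 4))) :=
        Real.exp_le_exp.mpr (neg_le_neg hsum)
    _ = ((H : ℝ) ^ (3 * dα * S ^ 4))⁻¹ * Real.exp (-((((A : ℝ) + 1) * (q : ℝ) * (S : ℝ)) ^ (18 * S ^ 4))) := by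
        rw [hHA, ← Real.exp_add]; congr 1; ring

/-- **ROY ⟹ ALGEBRAIC FRAME MEASURE** (`∃ C N`-form, `C = royC D`, `N = 8`). -/
theorem algFrameMeasure_of_roy (hRoy : Roy2014_thm_1_1) : AlgFrameMeasure :=
  fun D => ⟨royC D, 8, royC_nonneg D, algFrameMeasure_explicit_of_roy hRoy D⟩

end RoyAdapter

end Summit.Schanuel.Schanuel.Theorems.RootDecomp1BAlgFrame

end
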